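import Summits.ValiantsHypothesis.ValiantsHypothesis.Theorems.KPlusLogSqLawTropicalBTightRefinement
import Summits.ValiantsHypothesis.ValiantsHypothesis.Theorems.KPlusLogSqLawTropicalBGenericPerturbation
import Summits.ValiantsHypothesis.ValiantsHypothesis.Theorems.KPlusLogSqLawTropicalBTwoTermTie
import Summits.ValiantsHypothesis.ValiantsHypothesis.Theorems.KPlusLogSqLawTropicalBSignsFree

/-!
# Route «KPlusLogSqLaw», crux `TropicalB` (stmt-ValiantsHypothesis-19771) — the TIGHT / SINGLE-ORBIT NORMAL FORM of the unsigned row: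
# `TropRowD`, `DesignRowD d · ε` and `TropicalB` need only be proved for TIGHT chains, whose every step is ONE orbit of `σ_k⁻¹σ_{k+1}`

HONEST FRAMING.  Helper toward the registered stubs `stub_tropThin` / `stub_tropFat` of `Cruxes/TropicalB/Lines/birth.lean` (crux
`Summit.ValiantsHypothesis.ValiantsHypothesis.Theses.KPlusLogSqLaw.TropicalB`, item stmt-ValiantsHypothesis-19771, route KPlusLogSqLaw; cell
`pub-symmetroid`, seat val-sym-trop-p1 g25, 2026-08-29; `--supports … --as helper`).  A REDUCTION (w.l.o.g.) for the OPEN crux, assembled from part 1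
(`…TropicalBTightRefinement`, p681738), part 2 (`…TropicalBIncidenceCodes` p682006, `…TropicalBGenericPerturbation`) and the two-term tie law
(`…TropicalBTwoTermTie`, p678856).  Nothing here bounds `TropicalB` in its window; nothing bears on `WeakLifting`, DoorA26 / DoorA34, `MatrixDescartes`
(stmt-ValiantsHypothesis-18050) or VP ≠ VNP.

A chain `q₀, …, q_j` of terms dominant at integer slopes `ψ₀ < ⋯ < ψ_j` of a design `(d, v, ε)` is TIGHT (with tie slopes `τ_k`, `ψ_k < τ_k < ψ_{k+1}`) if
consecutive terms are distinct and at `τ_k` the two terms `q_k`, `q_{k+1}` have equal weight while every other present term is strictly lighter.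

* `designRowD_of_tight` — **if every TIGHT chain of every design `(d, v', ε)` (same exponents `d`, same support/signs `ε`, ANY valuations) has at most
  `B` steps, then `DesignRowD d v ε B` for every `v`**: an arbitrary unsigned dominant chain of `(d, v, ε)` survives the generic perturbation
  `v ↦ v'` of part 2 (same terms, slopes scaled) and is then refined to a tight chain at least as long (part 1).  Sector hypotheses on `(d, ε)` —
  Hessenberg, banded, static, lacunary exponents, … — are untouched by the reduction.
* `tropRowD_of_tight` — the format-level form: tight chains bounded by `B` in format `(m, K)` ⇒ `TropRowD m K B`.
* `designRowD_of_singleOrbit`, `tropRowD_of_singleOrbit` — by the two-term tie law every step of a tight chain has ALL its changed columns (row or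
  class changed) in ONE orbit of the quotient permutation `σ_k⁻¹σ_{k+1}`; so the unsigned rows need only be proved for chains with SINGLE-ORBIT STEPS
  (one alternating cycle carrying all class changes, or class changes inside one cycle of fixed columns… i.e. one fixed column).
* `tropicalB_iff_tight`, `tropicalB_iff_singleOrbit` — **`TropicalB` ⟺ the `2^(C (K + ⌊log₂ m⌋²))` bound for tight chains ⟺ the same bound for
  single-orbit chains** (through `tropicalB_iff_unsigned`, p444755's unsigned form).  This makes the cell's located observation «every step of every
  kernel census chain is ONE orbit» (CYCLE-POTENTIAL-g24 §2(a)) a w.l.o.g. of the crux: extremal unsigned chains may be assumed generic Newton-polygon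
  edge walks.
[folklore: generic position + «consecutive vertices of a Newton polygon span an edge»; the orbit statement is this cell's two-term tie law]
-/

set_option linter.dupNamespace false
set_option autoImplicit false

namespace Summit.ValiantsHypothesis.ValiantsHypothesis.Theorems.KPlusLogSqLaw

open Summit.ValiantsHypothesis.ValiantsHypothesis.Theorems.MatrixDescartes.Negative
open Summit.ValiantsHypothesis.ValiantsHypothesis.Theses.KPlusLogSqLaw (TropicalB)
open scoped BigOperators
open Finset

namespace TightChain

variable {m K : ℕ}

/-- **Tight normal form, design level.**  If every tight chain of every design `(d, v', ε)` has at most `B` steps then `DesignRowD d v ε B` for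
every `v`. [folklore] -/
theorem designRowD_of_tight (d : Fin K → ℕ) (ε : Fin m → Fin m → Fin K → ℤ) (B : ℕ)
    (h : ∀ (v : Fin m → Fin m → Fin K → ℤ) (j : ℕ) (q : Fin (j + 1) → Equiv.Perm (Fin m) × (Fin m → Fin K)) (ψ : Fin (j + 1) → ℤ)
      (τ : Fin j → ℤ),
      (∀ k, IsDominant d v ε (ψ k) (q k)) →
      (∀ k : Fin j, ψ k.castSucc < τ k ∧ τ k < ψ k.succ) →
      (∀ k : Fin j, q k.castSucc ≠ q k.succ) →
      (∀ k : Fin j, tropWeight d v (τ k) (q k.castSucc) = tropWeight d v (τ k) (q k.succ)) →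
      (∀ k : Fin j, ∀ r, termSign ε r ≠ 0 → r ≠ q k.castSucc → r ≠ q k.succ →
        tropWeight d v (τ k) r < tropWeight d v (τ k) (q k.castSucc)) →
      j ≤ B)
    (v : Fin m → Fin m → Fin K → ℤ) : DesignRowD d v ε B := by
  intro n θ p hθ hdom hne
  obtain ⟨v', c, hc, hdom', hG1, hG2, hG3⟩ := GenericPerturbation.exists_generic d v ε
  have hθ' : StrictMono (fun k => c * θ k) := fun a b hab => mul_lt_mul_of_pos_left (hθ hab) hc
  obtain ⟨j, q, ψ, τ, hnj, h1, h2, h3, h4, h5, -, -, -, -⟩ :=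
    exists_refinement d v' ε hG1 hG2 hG3 (fun k => c * θ k) p hθ' (fun k => hdom' _ _ (hdom k)) hne
  exact hnj.trans (h v' j q ψ τ h1 h2 h3 h4 h5)

/-- **Tight normal form, format level**: tight chains bounded by `B` in format `(m, K)` give `TropRowD m K B`. [folklore] -/
theorem tropRowD_of_tight (m K B : ℕ)
    (h : ∀ (d : Fin K → ℕ) (v ε : Fin m → Fin m → Fin K → ℤ) (j : ℕ) (q : Fin (j + 1) → Equiv.Perm (Fin m) × (Fin m → Fin K))
      (ψ : Fin (j + 1) → ℤ) (τ : Fin j → ℤ),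
      (∀ k, IsDominant d v ε (ψ k) (q k)) →
      (∀ k : Fin j, ψ k.castSucc < τ k ∧ τ k < ψ k.succ) →
      (∀ k : Fin j, q k.castSucc ≠ q k.succ) →
      (∀ k : Fin j, tropWeight d v (τ k) (q k.castSucc) = tropWeight d v (τ k) (q k.succ)) →
      (∀ k : Fin j, ∀ r, termSign ε r ≠ 0 → r ≠ q k.castSucc → r ≠ q k.succ →
        tropWeight d v (τ k) r < tropWeight d v (τ k) (q k.castSucc)) →
      j ≤ B) :
    TropRowD m K B :=
  fun d v ε => designRowD_of_tight d ε B (fun v' => h d v' ε) v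

/-- the exposing slopes of a tight chain increase strictly. [folklore] -/
theorem strictMono_of_separated {j : ℕ} (ψ : Fin (j + 1) → ℤ) (τ : Fin j → ℤ)
    (hsep : ∀ k : Fin j, ψ k.castSucc < τ k ∧ τ k < ψ k.succ) : StrictMono ψ := by
  rw [Fin.strictMono_iff_lt_succ]
  intro k
  exact (hsep k).1.trans (hsep k).2

/-- **Single-orbit normal form, design level.**  If every unsigned dominant chain of every design `(d, v', ε)` whose EVERY STEP has all its changed
columns in ONE orbit of `σ_k⁻¹σ_{k+1}` has at most `B` steps, then `DesignRowD d v ε B` for every `v`. [folklore] -/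
theorem designRowD_of_singleOrbit (d : Fin K → ℕ) (ε : Fin m → Fin m → Fin K → ℤ) (B : ℕ)
    (h : ∀ (v : Fin m → Fin m → Fin K → ℤ) (n : ℕ) (θ : Fin (n + 1) → ℤ) (p : Fin (n + 1) → Equiv.Perm (Fin m) × (Fin m → Fin K)),
      StrictMono θ → (∀ k, IsDominant d v ε (θ k) (p k)) → (∀ k : Fin n, p k.castSucc ≠ p k.succ) →
      (∀ k : Fin n, ∀ b₀ b : Fin m,
        ((p k.castSucc).1 b₀ ≠ (p k.succ).1 b₀ ∨ (p k.castSucc).2 b₀ ≠ (p k.succ).2 b₀) →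
        ((p k.castSucc).1 b ≠ (p k.succ).1 b ∨ (p k.castSucc).2 b ≠ (p k.succ).2 b) →
        Equiv.Perm.SameCycle ((p k.castSucc).1⁻¹ * (p k.succ).1) b₀ b) →
      n ≤ B)
    (v : Fin m → Fin m → Fin K → ℤ) : DesignRowD d v ε B := by
  refine designRowD_of_tight d ε B (fun v' j q ψ τ h1 h2 h3 h4 h5 => ?_) v
  refine h v' j ψ q (strictMono_of_separated ψ τ h2) h1 h3 fun k b₀ b hb₀ hb => ?_
  exact CyclePotential.sameCycle_of_changed d v' ε (h1 k.castSucc).1 (h1 k.succ).1 (h4 k)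
    (fun r hr hr1 hr2 => h5 k r hr hr1 hr2) hb₀ hb

/-- **Single-orbit normal form, format level.** [folklore] -/
theorem tropRowD_of_singleOrbit (m K B : ℕ)
    (h : ∀ (d : Fin K → ℕ) (v ε : Fin m → Fin m → Fin K → ℤ) (n : ℕ) (θ : Fin (n + 1) → ℤ)
      (p : Fin (n + 1) → Equiv.Perm (Fin m) × (Fin m → Fin K)),
      StrictMono θ → (∀ k, IsDominant d v ε (θ k) (p k)) → (∀ k : Fin n, p k.castSucc ≠ p k.succ) →
      (∀ k : Fin n, ∀ b₀ b : Fin m,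
        ((p k.castSucc).1 b₀ ≠ (p k.succ).1 b₀ ∨ (p k.castSucc).2 b₀ ≠ (p k.succ).2 b₀) →
        ((p k.castSucc).1 b ≠ (p k.succ).1 b ∨ (p k.castSucc).2 b ≠ (p k.succ).2 b) →
        Equiv.Perm.SameCycle ((p k.castSucc).1⁻¹ * (p k.succ).1) b₀ b) →
      n ≤ B) :
    TropRowD m K B :=
  fun d v ε => designRowD_of_singleOrbit d ε B (fun v' => h d v' ε) v

/-- **`TropicalB` ⟺ its bound for TIGHT chains** (two-term ties at integer slopes between consecutive exposing slopes). [folklore] -/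
theorem tropicalB_iff_tight :
    TropicalB ↔ ∃ C : ℕ, ∀ (m K : ℕ) (d : Fin K → ℕ) (v ε : Fin m → Fin m → Fin K → ℤ) (j : ℕ)
      (q : Fin (j + 1) → Equiv.Perm (Fin m) × (Fin m → Fin K)) (ψ : Fin (j + 1) → ℤ) (τ : Fin j → ℤ),
      (∀ k, IsDominant d v ε (ψ k) (q k)) →
      (∀ k : Fin j, ψ k.castSucc < τ k ∧ τ k < ψ k.succ) →
      (∀ k : Fin j, q k.castSucc ≠ q k.succ) →
      (∀ k : Fin j, tropWeight d v (τ k) (q k.castSucc) = tropWeight d v (τ k) (q k.succ)) →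
      (∀ k : Fin j, ∀ r, termSign ε r ≠ 0 → r ≠ q k.castSucc → r ≠ q k.succ →
        tropWeight d v (τ k) r < tropWeight d v (τ k) (q k.castSucc)) →
      j ≤ 2 ^ (C * (K + Nat.log 2 m ^ 2)) := by
  rw [tropicalB_iff_unsigned]
  constructor
  · rintro ⟨C, hC⟩
    exact ⟨C, fun m K d v ε j q ψ τ h1 h2 h3 _ _ => hC m K d v ε j ψ q (strictMono_of_separated ψ τ h2) h1 h3⟩
  · rintro ⟨C, hC⟩
    exact ⟨C, fun m K => tropRowD_of_tight m K _ (hC m K)⟩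

/-- **`TropicalB` ⟺ its bound for SINGLE-ORBIT chains** (every step: all changed columns in one orbit of `σ_k⁻¹σ_{k+1}`). [folklore] -/
theorem tropicalB_iff_singleOrbit :
    TropicalB ↔ ∃ C : ℕ, ∀ (m K : ℕ) (d : Fin K → ℕ) (v ε : Fin m → Fin m → Fin K → ℤ) (n : ℕ) (θ : Fin (n + 1) → ℤ)
      (p : Fin (n + 1) → Equiv.Perm (Fin m) × (Fin m → Fin K)),
      StrictMono θ → (∀ k, IsDominant d v ε (θ k) (p k)) → (∀ k : Fin n, p k.castSucc ≠ p k.succ) →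
      (∀ k : Fin n, ∀ b₀ b : Fin m,
        ((p k.castSucc).1 b₀ ≠ (p k.succ).1 b₀ ∨ (p k.castSucc).2 b₀ ≠ (p k.succ).2 b₀) →
        ((p k.castSucc).1 b ≠ (p k.succ).1 b ∨ (p k.castSucc).2 b ≠ (p k.succ).2 b) →
        Equiv.Perm.SameCycle ((p k.castSucc).1⁻¹ * (p k.succ).1) b₀ b) →
      n ≤ 2 ^ (C * (K + Nat.log 2 m ^ 2)) := by
  rw [tropicalB_iff_unsigned]
  constructor
  · rintro ⟨C, hC⟩
    exact ⟨C, fun m K d v ε n θ p hθ hdom hne _ => hC m K d v ε n θ p hθ hdom hne⟩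
  · rintro ⟨C, hC⟩
    exact ⟨C, fun m K => tropRowD_of_singleOrbit m K _ (hC m K)⟩

end TightChain

end Summit.ValiantsHypothesis.ValiantsHypothesis.Theorems.KPlusLogSqLaw
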